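import Mathlib
import Summits.NavierStokesRegularity.NavierStokesRegularity.Theorems.ThreadingFluxHorizonTowerProfileCurlT1
import HarnessLib

/-!
# Crux `PoloidalLiouville` (stmt-NavierStokesRegularity-1222, wall W1), crux idea «horizon-threading-tower» (ns-idea-15):
# RUNG R5 of the identification chain — the second contraction `⟪x, curl(U × curl λ)(x)⟫ = −2κ l(l+1) (‖x‖²)^{(1−3l)/2} · det(∇H, ∇G, x)`

Support file (Theorems-side tooling, `--supports stmt-NavierStokesRegularity-1222 --as helper`; seat ns-wall-eng-7 g3, cell ns-wall-extremal).
Fifth rung of the STRUCTURED identification chain of the engine identity E-𝔏₂ (DATUM B-ht2, `pub/ns-wall-extremal/ARM-B/w7g3/L2-IDENTITY.md` §2 (5)).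
With `U = U_H`, `λ = U × curl U`, `κ = (l−1)(l+2)`, `G = ‖∇H‖²`, `D(x) = ⟪x, ∇H(x) × ∇G(x)⟫`:

* `HorizonTower.cross_U_curlLamb_pointwise` — the algebra `(A∇H + By) × (p ∇H×y + q ∇G×y) = … ∇H + … ∇G + … y`;
* `HorizonTower.inner_cross_combination_right` / `inner_cross_pair_left` — the two contractions with `x`;
* `HorizonTower.crossUCurlLamb_horizonProfile` — `U × curl λ` in closed form off the origin (`α′ ∇H + δ ∇G + β′ x`);
* `HorizonTower.inner_curl_crossUCurlLamb_horizonProfile` — ★ `⟪x, curl(U × curl λ)(x)⟫ = (−2κ l(l+1)(‖x‖²)^{(1−3l)/2}) · D(x)`.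

Pure vector calculus; information-grade for W1/W2; `PoloidalLiouville` (1222) / NS regularity OPEN and untouched. [folklore]
-/

-- the summit and its single problem share the name (D-0017 nested layout)
set_option linter.dupNamespace false

noncomputable section

open Set Function Filter Topology
open scoped Topology RealInnerProductSpace
open Literature.Analysis.FluidPDE
open Literature.Geometry.DiscreteGeometry (inner_fin3 norm_sq_fin3)

namespace Summit.NavierStokesRegularity.NavierStokesRegularity.Theorems.PoloidalLiouville.HorizonTower

open PoloidalField

/-- BAC–CAB bookkeeping: `(A g + B y) × (p (g × y) + q (v × y))
 = (p(A⟪g,y⟫ + B⟪y,y⟫)) g + (q(A⟪g,y⟫ + B⟪y,y⟫)) v − (A(p‖g‖² + q⟪g,v⟫) + B(p⟪g,y⟫ + q⟪y,v⟫)) y`. [cite: MajdaBertozziCUP2002, §1.1 (vector identities)] -/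
theorem cross_U_curlLamb_pointwise (g v y : E3) (A B p q L R : ℝ) (hEu : ⟪g, y⟫ = L) (hR : ⟪y, y⟫ = R) :
    cross (A • g + B • y) (p • cross g y + q • cross v y)
      = (p * (A * L + B * R)) • g + (q * (A * L + B * R)) • v + (-(A * (p * ‖g‖ ^ 2 + q * ⟪g, v⟫) + B * (p * L + q * ⟪y, v⟫))) • y := by
  rw [inner_fin3] at hEu hR
  rw [norm_sq_fin3, inner_fin3 g v, inner_fin3 y v]
  obtain ⟨c0, c1, c2⟩ := cross_fin3 g y
  obtain ⟨d0, d1, d2⟩ := cross_fin3 v y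
  obtain ⟨e0, e1, e2⟩ := cross_fin3 (A • g + B • y) (p • cross g y + q • cross v y)
  ext i
  fin_cases i
  · simp only [Fin.zero_eta, Fin.isValue, PiLp.add_apply, PiLp.smul_apply, smul_eq_mul, e0, c1, c2, d1, d2]
    linear_combination (g 0 * A * p + v 0 * A * q - y 0 * B * p) * hEu + (g 0 * B * p + v 0 * B * q) * hR
  · simp only [Fin.mk_one, Fin.isValue, PiLp.add_apply, PiLp.smul_apply, smul_eq_mul, e1, c0, c2, d0, d2]
    linear_combination (g 1 * A * p + v 1 * A * q - y 1 * B * p) * hEu + (g 1 * B * p + v 1 * B * q) * hR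
  · simp only [Fin.reduceFinMk, Fin.isValue, PiLp.add_apply, PiLp.smul_apply, smul_eq_mul, e2, c0, c1, d0, d1]
    linear_combination (g 2 * A * p + v 2 * A * q - y 2 * B * p) * hEu + (g 2 * B * p + v 2 * B * q) * hR

/-- `⟪x, (p • u + q • x) × w⟫ = p ⟪x, u × w⟫`. [folklore] -/
theorem inner_cross_pair_left (p q : ℝ) (u w x : E3) : ⟪x, cross (p • u + q • x) w⟫ = p * ⟪x, cross u w⟫ := by
  obtain ⟨c0, c1, c2⟩ := cross_fin3 (p • u + q • x) w
  obtain ⟨d0, d1, d2⟩ := cross_fin3 u w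
  rw [inner_fin3, inner_fin3, c0, c1, c2, d0, d1, d2]
  simp only [PiLp.add_apply, PiLp.smul_apply, smul_eq_mul]
  ring

/-- `⟪x, u × u⟫ = 0`, in the form `⟪x, (p • u + q • x) × u⟫ = 0`. [folklore] -/
theorem inner_cross_pair_left_self (p q : ℝ) (u x : E3) : ⟪x, cross (p • u + q • x) u⟫ = 0 := by
  obtain ⟨c0, c1, c2⟩ := cross_fin3 (p • u + q • x) u
  rw [inner_fin3, c0, c1, c2]
  simp only [PiLp.add_apply, PiLp.smul_apply, smul_eq_mul]
  ring

section T2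

variable {l : ℕ} {H : E3 → ℝ}

/-- `G = ‖∇H‖²` is smooth when `H` is. -/
theorem contDiff_gradNormSq (hH : ContDiff ℝ (⊤ : ℕ∞) H) {n : WithTop ℕ∞} (hn : n ≤ (⊤ : ℕ∞)) :
    ContDiff ℝ n (fun y => ‖gradient H y‖ ^ 2) :=
  (contDiff_gradient hH hn).norm_sq ℝ

/-- **`U × curl λ` in closed form** off the origin: `U × curl λ = α′ • ∇H + δ • ∇G + β′ • x` with
`α′ = 4κl³(l+1) H²(‖x‖²)^{−(3l+1)/2}`, `δ = −2κl(l+1) H(‖x‖²)^{(1−3l)/2}`, `β′` explicit (`K = ⟪∇H,∇G⟫`, `M = ⟪x,∇G⟫`). [folklore] -/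
theorem crossUCurlLamb_horizonProfile (hl : 1 ≤ l) (hH : ContDiff ℝ (⊤ : ℕ∞) H)
    (hhom : ∀ (c : ℝ) (y : E3), H (c • y) = c ^ l * H y) (hharm : ∀ y, Laplacian.laplacian H y = 0) {x : E3} (hx : x ≠ 0) :
    cross (horizonProfile l H 0 x) (curl (fun y => cross (horizonProfile l H 0 y) (curl (horizonProfile l H 0) y)) x)
      = ((4 * (((l : ℝ) - 1) * ((l : ℝ) + 2)) * (l : ℝ) ^ 3 * ((l : ℝ) + 1)) * (H x ^ 2 * (‖x‖ ^ 2) ^ (-(3 * (l : ℝ) + 1) / 2))) • gradient H x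
        + ((-2 * (((l : ℝ) - 1) * ((l : ℝ) + 2)) * (l : ℝ) * ((l : ℝ) + 1)) * (H x * (‖x‖ ^ 2) ^ ((1 - 3 * (l : ℝ)) / 2)))
            • gradient (fun y => ‖gradient H y‖ ^ 2) x
        + ((-8 * (((l : ℝ) - 1) * ((l : ℝ) + 2)) * (l : ℝ) ^ 2) * (H x * ‖gradient H x‖ ^ 2 * (‖x‖ ^ 2) ^ (-(3 * (l : ℝ) + 1) / 2))
            + (4 * (((l : ℝ) - 1) * ((l : ℝ) + 2))) * (⟪gradient H x, gradient (fun y => ‖gradient H y‖ ^ 2) x⟫ * (‖x‖ ^ 2) ^ ((1 - 3 * (l : ℝ)) / 2))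
            + (-4 * (((l : ℝ) - 1) * ((l : ℝ) + 2)) * (l : ℝ) ^ 4 * ((l : ℝ) - 1)) * (H x ^ 3 * (‖x‖ ^ 2) ^ (-(3 * (l : ℝ) + 3) / 2))
            + (2 * (((l : ℝ) - 1) * ((l : ℝ) + 2)) * (l : ℝ) * ((l : ℝ) - 1))
                * (H x * ⟪x, gradient (fun y => ‖gradient H y‖ ^ 2) x⟫ * (‖x‖ ^ 2) ^ (-(3 * (l : ℝ) + 1) / 2))) • x := by
  have hHd : DifferentiableAt ℝ H x := (hH.differentiable (by simp)).differentiableAt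
  have hq : 0 < ‖x‖ ^ 2 := by positivity
  have hEu : ⟪gradient H x, x⟫ = (l : ℝ) * H x := by rw [inner_gradient_eq_fderiv, fderiv_apply_self_of_homogeneous_nat hHd hhom]
  have hR : ⟪x, x⟫ = ‖x‖ ^ 2 := real_inner_self_eq_norm_sq x
  have hsub : ∀ (a b : ℝ) (u v : E3), a • u - b • v = a • u + (-b) • v := fun a b u v => by rw [neg_smul, sub_eq_add_neg]
  rw [horizonProfile_eq_rpow hl hH hhom hharm hx, curl_lamb_horizonProfile hl hH hhom hharm hx, hsub,
    cross_U_curlLamb_pointwise _ _ _ _ _ _ _ _ _ hEu hR]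
  -- powers of ‖x‖²
  have s1 : (‖x‖ ^ 2) ^ (((1 : ℝ) - l) / 2) * (‖x‖ ^ 2) ^ (-(l : ℝ) - 1) = (‖x‖ ^ 2) ^ (-(3 * (l : ℝ) + 1) / 2) := by
    rw [← Real.rpow_add hq]; congr 1; ring
  have s2 : (‖x‖ ^ 2) ^ (((1 : ℝ) - l) / 2) * (‖x‖ ^ 2) ^ (-(l : ℝ)) = (‖x‖ ^ 2) ^ ((1 - 3 * (l : ℝ)) / 2) := by
    rw [← Real.rpow_add hq]; congr 1; ring
  have s3 : (‖x‖ ^ 2) ^ (((1 : ℝ) - l) / 2 - 1) * (‖x‖ ^ 2) ^ (-(l : ℝ) - 1) * ‖x‖ ^ 2 = (‖x‖ ^ 2) ^ (-(3 * (l : ℝ) + 1) / 2) := by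
    conv_lhs => rw [show (‖x‖ ^ 2) ^ (((1 : ℝ) - l) / 2 - 1) * (‖x‖ ^ 2) ^ (-(l : ℝ) - 1) * ‖x‖ ^ 2
      = (‖x‖ ^ 2) ^ (((1 : ℝ) - l) / 2 - 1) * (‖x‖ ^ 2) ^ (-(l : ℝ) - 1) * (‖x‖ ^ 2) ^ (1 : ℝ) by rw [Real.rpow_one]]
    rw [← Real.rpow_add hq, ← Real.rpow_add hq]; congr 1; ring
  have s4 : (‖x‖ ^ 2) ^ (((1 : ℝ) - l) / 2 - 1) * (‖x‖ ^ 2) ^ (-(l : ℝ)) * ‖x‖ ^ 2 = (‖x‖ ^ 2) ^ ((1 - 3 * (l : ℝ)) / 2) := by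
    conv_lhs => rw [show (‖x‖ ^ 2) ^ (((1 : ℝ) - l) / 2 - 1) * (‖x‖ ^ 2) ^ (-(l : ℝ)) * ‖x‖ ^ 2
      = (‖x‖ ^ 2) ^ (((1 : ℝ) - l) / 2 - 1) * (‖x‖ ^ 2) ^ (-(l : ℝ)) * (‖x‖ ^ 2) ^ (1 : ℝ) by rw [Real.rpow_one]]
    rw [← Real.rpow_add hq, ← Real.rpow_add hq]; congr 1; ring
  have s5 : (‖x‖ ^ 2) ^ (((1 : ℝ) - l) / 2 - 1) * (‖x‖ ^ 2) ^ (-(l : ℝ) - 1) = (‖x‖ ^ 2) ^ (-(3 * (l : ℝ) + 3) / 2) := by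
    rw [← Real.rpow_add hq]; congr 1; ring
  have s6 : (‖x‖ ^ 2) ^ (((1 : ℝ) - l) / 2 - 1) * (‖x‖ ^ 2) ^ (-(l : ℝ)) = (‖x‖ ^ 2) ^ (-(3 * (l : ℝ) + 1) / 2) := by
    rw [← Real.rpow_add hq]; congr 1; ring
  congr 1
  · congr 1
    · congr 1
      linear_combination (8 * (((l : ℝ) - 1) * ((l : ℝ) + 2)) * (l : ℝ) ^ 3 * H x ^ 2) * s1
        + (4 * (((l : ℝ) - 1) * ((l : ℝ) + 2)) * (l : ℝ) ^ 3 * ((l : ℝ) - 1) * H x ^ 2) * s3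
    · congr 1
      linear_combination (-4 * (((l : ℝ) - 1) * ((l : ℝ) + 2)) * (l : ℝ) * H x) * s2
        + (-2 * (((l : ℝ) - 1) * ((l : ℝ) + 2)) * (l : ℝ) * ((l : ℝ) - 1) * H x) * s4
  · congr 1
    linear_combination (-8 * (((l : ℝ) - 1) * ((l : ℝ) + 2)) * (l : ℝ) ^ 2 * H x * ‖gradient H x‖ ^ 2) * s1
      + (4 * (((l : ℝ) - 1) * ((l : ℝ) + 2)) * ⟪gradient H x, gradient (fun y => ‖gradient H y‖ ^ 2) x⟫) * s2
      + (-4 * (((l : ℝ) - 1) * ((l : ℝ) + 2)) * (l : ℝ) ^ 4 * ((l : ℝ) - 1) * H x ^ 3) * s5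
      + (2 * (((l : ℝ) - 1) * ((l : ℝ) + 2)) * (l : ℝ) * ((l : ℝ) - 1) * H x * ⟪x, gradient (fun y => ‖gradient H y‖ ^ 2) x⟫) * s6

/-- ★ **R5: the second contraction.**  `⟪x, curl(U × curl λ)(x)⟫ = (−2κl(l+1)(‖x‖²)^{(1−3l)/2}) · ⟪x, ∇H(x) × ∇G(x)⟫`. [folklore] -/
theorem inner_curl_crossUCurlLamb_horizonProfile (hl : 1 ≤ l) (hH : ContDiff ℝ (⊤ : ℕ∞) H)
    (hhom : ∀ (c : ℝ) (y : E3), H (c • y) = c ^ l * H y) (hharm : ∀ y, Laplacian.laplacian H y = 0) {x : E3} (hx : x ≠ 0) :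
    ⟪x, curl (fun z => cross (horizonProfile l H 0 z)
        (curl (fun w => cross (horizonProfile l H 0 w) (curl (horizonProfile l H 0) w)) z)) x⟫
      = (-2 * (((l : ℝ) - 1) * ((l : ℝ) + 2)) * (l : ℝ) * ((l : ℝ) + 1) * (‖x‖ ^ 2) ^ ((1 - 3 * (l : ℝ)) / 2))
          * ⟪x, cross (gradient H x) (gradient (fun y => ‖gradient H y‖ ^ 2) x)⟫ := by
  have hHd : ∀ z, DifferentiableAt ℝ H z := fun z => (hH.differentiable (by simp)).differentiableAt
  have hGd : ∀ z, DifferentiableAt ℝ (gradient H) z :=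
    fun z => ((contDiff_gradient hH (n := 1) (by norm_cast)).differentiable (by simp)).differentiableAt
  have hNd : ∀ z, DifferentiableAt ℝ (fun y => ‖gradient H y‖ ^ 2) z := fun z => (hGd z).norm_sq ℝ
  have hN2 : ∀ z, ContDiffAt ℝ 2 (fun y => ‖gradient H y‖ ^ 2) z := fun z => (contDiff_gradNormSq hH (by norm_cast)).contDiffAt
  have hVd : ∀ z, DifferentiableAt ℝ (gradient (fun y => ‖gradient H y‖ ^ 2)) z := fun z =>
    ((contDiff_gradient (H := fun y => ‖gradient H y‖ ^ 2) (contDiff_gradNormSq hH le_rfl) (n := 1) (by norm_cast)).differentiable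
      (by simp)).differentiableAt
  have hopen : ∀ᶠ y in 𝓝 x, y ≠ (0 : E3) := isOpen_compl_singleton.mem_nhds hx
  set κ : ℝ := ((l : ℝ) - 1) * ((l : ℝ) + 2) with hκ
  set α : E3 → ℝ := fun y => (4 * κ * (l : ℝ) ^ 3 * ((l : ℝ) + 1)) * (H y ^ 2 * (‖y‖ ^ 2) ^ (-(3 * (l : ℝ) + 1) / 2)) with hα
  set δ : E3 → ℝ := fun y => (-2 * κ * (l : ℝ) * ((l : ℝ) + 1)) * (H y * (‖y‖ ^ 2) ^ ((1 - 3 * (l : ℝ)) / 2)) with hδ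
  set β : E3 → ℝ := fun y => (-8 * κ * (l : ℝ) ^ 2) * (H y * ‖gradient H y‖ ^ 2 * (‖y‖ ^ 2) ^ (-(3 * (l : ℝ) + 1) / 2))
      + (4 * κ) * (⟪gradient H y, gradient (fun w => ‖gradient H w‖ ^ 2) y⟫ * (‖y‖ ^ 2) ^ ((1 - 3 * (l : ℝ)) / 2))
      + (-4 * κ * (l : ℝ) ^ 4 * ((l : ℝ) - 1)) * (H y ^ 3 * (‖y‖ ^ 2) ^ (-(3 * (l : ℝ) + 3) / 2))
      + (2 * κ * (l : ℝ) * ((l : ℝ) - 1)) * (H y * ⟪y, gradient (fun w => ‖gradient H w‖ ^ 2) y⟫ * (‖y‖ ^ 2) ^ (-(3 * (l : ℝ) + 1) / 2))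
    with hβ
  have hev : (fun z => cross (horizonProfile l H 0 z)
        (curl (fun w => cross (horizonProfile l H 0 w) (curl (horizonProfile l H 0) w)) z))
      =ᶠ[𝓝 x] fun y => α y • gradient H y + δ y • gradient (fun w => ‖gradient H w‖ ^ 2) y + β y • y := by
    filter_upwards [hopen] with y hy
    rw [crossUCurlLamb_horizonProfile hl hH hhom hharm hy]
  rw [curl_eq_curlCLM, hev.fderiv_eq, ← curl_eq_curlCLM]
  -- differentiability at x
  have hR : ∀ p : ℝ, DifferentiableAt ℝ (fun y : E3 => (‖y‖ ^ 2) ^ p) x := fun p =>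
    (contDiffAt_rpow_normSq hx p (n := 1)).differentiableAt (by simp)
  have hH2 : DifferentiableAt ℝ (fun y => H y ^ 2) x := (hHd x).pow 2
  have hH3 : DifferentiableAt ℝ (fun y => H y ^ 3) x := (hHd x).pow 3
  have hK : DifferentiableAt ℝ (fun y => ⟪gradient H y, gradient (fun w => ‖gradient H w‖ ^ 2) y⟫) x := (hGd x).inner ℝ (hVd x)
  have hM : DifferentiableAt ℝ (fun y : E3 => ⟪y, gradient (fun w => ‖gradient H w‖ ^ 2) y⟫) x := differentiableAt_id.inner ℝ (hVd x)
  have hρ1 : DifferentiableAt ℝ (fun y : E3 => H y ^ 2 * (‖y‖ ^ 2) ^ (-(3 * (l : ℝ) + 1) / 2)) x := hH2.mul (hR _)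
  have hρ2 : DifferentiableAt ℝ (fun y : E3 => H y * (‖y‖ ^ 2) ^ ((1 - 3 * (l : ℝ)) / 2)) x := (hHd x).mul (hR _)
  have hρ3 : DifferentiableAt ℝ (fun y : E3 => H y * ‖gradient H y‖ ^ 2 * (‖y‖ ^ 2) ^ (-(3 * (l : ℝ) + 1) / 2)) x :=
    ((hHd x).mul (hNd x)).mul (hR _)
  have hρ4 : DifferentiableAt ℝ (fun y : E3 => ⟪gradient H y, gradient (fun w => ‖gradient H w‖ ^ 2) y⟫
      * (‖y‖ ^ 2) ^ ((1 - 3 * (l : ℝ)) / 2)) x := hK.mul (hR _)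
  have hρ5 : DifferentiableAt ℝ (fun y : E3 => H y ^ 3 * (‖y‖ ^ 2) ^ (-(3 * (l : ℝ) + 3) / 2)) x := hH3.mul (hR _)
  have hρ6 : DifferentiableAt ℝ (fun y : E3 => H y * ⟪y, gradient (fun w => ‖gradient H w‖ ^ 2) y⟫
      * (‖y‖ ^ 2) ^ (-(3 * (l : ℝ) + 1) / 2)) x := ((hHd x).mul hM).mul (hR _)
  have hαd : DifferentiableAt ℝ α x := hρ1.const_mul _
  have hδd : DifferentiableAt ℝ δ x := hρ2.const_mul _
  have hβd : DifferentiableAt ℝ β x := (((hρ3.const_mul _).add (hρ4.const_mul _)).add (hρ5.const_mul _)).add (hρ6.const_mul _)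
  have h1 : DifferentiableAt ℝ (fun y => α y • gradient H y) x := hαd.smul (hGd x)
  have h2 : DifferentiableAt ℝ (fun y => δ y • gradient (fun w => ‖gradient H w‖ ^ 2) y) x := hδd.smul (hVd x)
  have h3 : DifferentiableAt ℝ (fun y => β y • y) x := hβd.smul differentiableAt_id
  have h12 : DifferentiableAt ℝ (fun y => α y • gradient H y + δ y • gradient (fun w => ‖gradient H w‖ ^ 2) y) x := h1.add h2
  rw [curl_eq_curlCLM, fderiv_fun_add h12 h3, fderiv_fun_add h1 h2, map_add, map_add, ← curl_eq_curlCLM, ← curl_eq_curlCLM,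
    ← curl_eq_curlCLM, curl_smul_eq_cross hαd (hGd x), curl_smul_eq_cross hδd (hVd x), curl_smul_self hβd,
    curl_gradient_eq_zero_of_contDiffAt (hH.contDiffAt.of_le (by norm_cast)), curl_gradient_eq_zero_of_contDiffAt (hN2 x),
    smul_zero, zero_add, smul_zero, zero_add, inner_add_right, inner_add_right, inner_cross_self_right, add_zero]
  -- gradients of α and δ
  have hG2 : gradient (fun y => H y ^ 2) x = (2 * H x) • gradient H x := by
    have : (fun y => H y ^ 2) = fun y => H y * H y := funext fun y => sq (H y)
    rw [this, gradient_mul_apply (hHd x) (hHd x), ← add_smul]; congr 1; ring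
  have hgα : gradient α x = (4 * κ * (l : ℝ) ^ 3 * ((l : ℝ) + 1)) • ((‖x‖ ^ 2) ^ (-(3 * (l : ℝ) + 1) / 2) • ((2 * H x) • gradient H x)
        + (2 * ((-(3 * (l : ℝ) + 1) / 2) * (‖x‖ ^ 2) ^ (-(3 * (l : ℝ) + 1) / 2 - 1)) * H x ^ 2) • x) := by
    rw [hα, gradient_mul_apply (differentiableAt_const _) hρ1, gradient_mul_rpow_normSq hx hH2, hG2]
    have h0 : gradient (fun _ : E3 => 4 * κ * (l : ℝ) ^ 3 * ((l : ℝ) + 1)) x = 0 := by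
      unfold gradient; rw [fderiv_const_apply]; simp
    rw [h0, smul_zero, add_zero]
  have hgδ : gradient δ x = (-2 * κ * (l : ℝ) * ((l : ℝ) + 1)) • ((‖x‖ ^ 2) ^ ((1 - 3 * (l : ℝ)) / 2) • gradient H x
        + (2 * (((1 - 3 * (l : ℝ)) / 2) * (‖x‖ ^ 2) ^ ((1 - 3 * (l : ℝ)) / 2 - 1)) * H x) • x) := by
    rw [hδ, gradient_mul_apply (differentiableAt_const _) hρ2, gradient_mul_rpow_normSq hx (hHd x)]
    have h0 : gradient (fun _ : E3 => -2 * κ * (l : ℝ) * ((l : ℝ) + 1)) x = 0 := by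
      unfold gradient; rw [fderiv_const_apply]; simp
    rw [h0, smul_zero, add_zero]
  rw [hgα, hgδ]
  have hgrp1 : (4 * κ * (l : ℝ) ^ 3 * ((l : ℝ) + 1)) • ((‖x‖ ^ 2) ^ (-(3 * (l : ℝ) + 1) / 2) • ((2 * H x) • gradient H x)
        + (2 * ((-(3 * (l : ℝ) + 1) / 2) * (‖x‖ ^ 2) ^ (-(3 * (l : ℝ) + 1) / 2 - 1)) * H x ^ 2) • x)
      = (4 * κ * (l : ℝ) ^ 3 * ((l : ℝ) + 1) * ((‖x‖ ^ 2) ^ (-(3 * (l : ℝ) + 1) / 2) * (2 * H x))) • gradient H x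
        + (4 * κ * (l : ℝ) ^ 3 * ((l : ℝ) + 1) * (2 * ((-(3 * (l : ℝ) + 1) / 2) * (‖x‖ ^ 2) ^ (-(3 * (l : ℝ) + 1) / 2 - 1)) * H x ^ 2)) • x := by
    module
  have hgrp2 : (-2 * κ * (l : ℝ) * ((l : ℝ) + 1)) • ((‖x‖ ^ 2) ^ ((1 - 3 * (l : ℝ)) / 2) • gradient H x
        + (2 * (((1 - 3 * (l : ℝ)) / 2) * (‖x‖ ^ 2) ^ ((1 - 3 * (l : ℝ)) / 2 - 1)) * H x) • x)
      = (-2 * κ * (l : ℝ) * ((l : ℝ) + 1) * (‖x‖ ^ 2) ^ ((1 - 3 * (l : ℝ)) / 2)) • gradient H x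
        + (-2 * κ * (l : ℝ) * ((l : ℝ) + 1) * (2 * (((1 - 3 * (l : ℝ)) / 2) * (‖x‖ ^ 2) ^ ((1 - 3 * (l : ℝ)) / 2 - 1)) * H x)) • x := by
    module
  rw [hgrp1, hgrp2, inner_cross_pair_left_self, inner_cross_pair_left, zero_add]

end T2

end Summit.NavierStokesRegularity.NavierStokesRegularity.Theorems.PoloidalLiouville.HorizonTower

end
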